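import Summits.BirchSwinnertonDyer.Rank1Residual.Additive.KatoDescentDatum
import Literature.NumberTheory.EllipticCurves.Kato2004.LatticeChangeSkeletonProofs
import HarnessLib

/-!
# The Kato descent datum under an ISOGENY: `KMC_p` (Conj. 12.10 on the trivial component) is an
# invariant of the `ℚ`-isogeny class, over the lattice-change reading
# (cell `bsd-potss`, seat `kmc`, generation 6; part 13 of the descent files; kernel assembly over
# `Literature/…/Kato2004/LatticeChangeSkeletonProofs.lean`; nothing asserted)

HONEST FRAMING (cell `bsd-potss`, `run/shared/lean/pub/bsd-potss/`, FULL-BSD rank-`≤ 1` programme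
tranche 1b, rows B4/B5; typed against part 1 `Additive/KatoDescentDatum.lean`): NOTHING about Kato's
Main Conjecture is asserted and no Literature fact is minted. The route `KatoDescentPotSupersingular`
speaks of "KMC₃ for `(f_E, 3)`" — a property of the newform, i.e. of the ISOGENY CLASS — while the
descent files (parts 1–12) read the interface `KMC W p` at a CURVE (`T = T_pW`); Kato states Conj. 12.10
for every stable lattice `T` (p. 224) without comparing lattices. This file records, over ONE displayed
reading, that the two agree: for `ℚ`-isogenous `W ∼ W'` with realised data `D`, `D'`,
**`KMC W p ↔ KMC W' p`**.

## The mathematics (memo v5 §5 of `HOME/bsd-potss-kmc/KMC-DESCENT-MEMO-v5.md`)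

An isogeny `φ : W' → W` embeds `T' := φ(T_pW') ≅ T_pW'` in `T := T_pW` with finite quotient `C`
(`p` odd; `C = C⁺ ⊕ C⁻` under complex conjugation). Kato's `𝐇^q` (8.2) give, on the `Δ`-trivial
component, the exact `0 = 𝐇⁰(C) → 𝐇¹(T') →f₁ 𝐇¹(T) → 𝐇¹(C) → 𝐇²(T') →f₂ 𝐇²(T) → 𝐇²(C) → 0` (`cd_p = 2`);
the zeta elements satisfy `f₁(z') = c·z` with `c = u·p^a`, `p^a = [T(−1)⁺ : T'(−1)⁺] = #C⁻` (Thm. 12.5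
(1)–(2) / 14.5 (2): `z_γ⁰` depends only on `γ⁺ ∈ T(−1)⁺ = T⁻ ⊗ ℤ_p(−1)`); and Tate's global
Euler–Poincaré characteristic over the totally real layers `ℚ_n` (`#H⁰·#H²/#H¹ = #M^{c=1}/#M`) gives
`μ(𝐇¹(C)⁰) − μ(𝐇²(C)⁰) = ord_p #C − ord_p #C⁺ = ord_p #C⁻ = a`, i.e. `ℓ_𝔮(𝐇¹(C)⁰) = ℓ_𝔮(𝐇²(C)⁰) +
ℓ_𝔮(Λ/(c))` at `𝔮 = (p)`, and trivially (`0 = 0 + 0`) at the other height-one primes (`𝐇^q(C)` is killed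
by `#C`, `c ∣ p^a`). The tree theorem `Kato2004.lengthAt_eq_iff_of_latticeChange` (the six-term length
identity `ℓ(H2) + ℓ(X₁) + ℓ(H'/Λz') = ℓ(H2') + ℓ(X₂) + ℓ(H/Λz) + ℓ(Λ/(c))`) then says: at every height-one
`𝔮`, `ℓ_𝔮(𝐇²(T)) = ℓ_𝔮(𝐇¹(T)/Λz)` iff `ℓ_𝔮(𝐇²(T')) = ℓ_𝔮(𝐇¹(T')/Λz')` — Conj. 12.10⁰ for `T` iff for
`T'` (and the same for the divisibility of Thm. 12.5 (4)). The twist `T(−1)` is what makes the two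
shifts agree (`#C⁻` on both sides).

## Contents

* §1 `KatoDescentDatum.LatticeChange D' D` — the interface for the six-term sequence between two data
  + the zeta relation; `LatticeChange.EulerCharIdentity`; kernel theorems
  `LatticeChange.conj1210_iff`, `LatticeChange.divisibility_iff` (from part 13a).
* §2 the reading `LatticeChangeReading IsOf` (hypothesis schema: isogenous curves with realised data
  carry a lattice change with the Euler-characteristic identity; the carriers `X₁`, `X₂` are objects of `ModuleCat Λ`, so no `instance` is declared) and
  **`kmc_iff_of_isIsogenous`** (`KMC W p ↔ KMC W' p` over `ReadsTrivialKMC` + the reading).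

WHAT THIS IS NOT. Not a claim that realised data EXIST at both curves (that is part 1's `Realizable`
under (12.5.2), part 8a's `TorsionFree.RealizableOfKMC` at `p ∤ #tors`, part 12's hull data at Kato's
member); no integrality transport (`z' ∈ 𝐇¹(T')` is part of `D'`); nothing at `p = 2`; nothing is booked.

References: K. Kato, Astérisque 295 (2004): 8.2 (pp. 180–181), Thm. 12.5 (1)–(2) (p. 221), Conj. 12.10
(p. 224), Thm. 14.5 (2) (p. 236) [Kato2004Asterisque]; J. Neukirch, A. Schmidt, K. Wingberg,
*Cohomology of Number Fields* (8.7.4) [NeukirchSchmidtWingberg2008]; R. Greenberg, LNM 1716 §4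
[GreenbergLNM1716].
-/

set_option autoImplicit false

noncomputable section

open scoped Classical

open WeierstrassCurve Literature.NumberTheory.EllipticCurves
  Literature.NumberTheory.EllipticCurves.Rank1Residual
  Literature.NumberTheory.EllipticCurves.IwasawaAlgebra

namespace Summit.BirchSwinnertonDyer.Rank1Residual.Additive

namespace KatoDescentDatum

variable {p : ℕ} [Fact p.Prime]

/-! ## §1 The interface: a lattice change between two descent data -/

/-- **INTERFACE: the six-term `Λ`-adic sequence of a lattice change `0 → T' → T → C → 0` between two
Kato descent data `D'` (for `T'`) and `D` (for `T`), on the trivial component** (Kato 8.2, `cd_p = 2`,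
`𝐇⁰(C) = 0`): `0 → D'.H →f₁ D.H →g₁ X₁ →δ D'.H2 →f₂ D.H2 →g₂ X₂ → 0` exact with `X₁ = 𝐇¹(C)⁰`,
`X₂ = 𝐇²(C)⁰` (finitely generated torsion: killed by `#C`), and the zeta relation `f₁ D'.z = c • D.z`,
`c ≠ 0` (`c = u·p^a`, `p^a = [T(−1)⁺ : T'(−1)⁺]`, Thm. 12.5 (1)–(2)). Names modules and maps only.
[cite: Kato2004Asterisque, 8.2 (pp. 180–181), Thm. 12.5 (1)–(2) (p. 221)] -/
structure LatticeChange (D' D : KatoDescentDatum p) : Type 1 where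
  /-- `𝐇¹(C)⁰`, as an object of `ModuleCat Λ` (no instance is declared in this file). -/
  X₁ : ModuleCat.{0} (IwasawaAlgebra p)
  /-- `𝐇²(C)⁰`. -/
  X₂ : ModuleCat.{0} (IwasawaAlgebra p)
  finX₂ : Module.Finite (IwasawaAlgebra p) X₂
  isTorsion_X₂ : Module.IsTorsion (IwasawaAlgebra p) X₂
  /-- `𝐇¹(T') → 𝐇¹(T)`. -/
  f₁ : D'.H →ₗ[IwasawaAlgebra p] D.H
  /-- `𝐇¹(T) → 𝐇¹(C)`. -/
  g₁ : D.H →ₗ[IwasawaAlgebra p] X₁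
  /-- the connecting map `𝐇¹(C) → 𝐇²(T')`. -/
  δ : X₁ →ₗ[IwasawaAlgebra p] D'.H2
  /-- `𝐇²(T') → 𝐇²(T)`. -/
  f₂ : D'.H2 →ₗ[IwasawaAlgebra p] D.H2
  /-- `𝐇²(T) → 𝐇²(C)`. -/
  g₂ : D.H2 →ₗ[IwasawaAlgebra p] X₂
  f₁_injective : Function.Injective f₁
  exact₁ : Function.Exact f₁ g₁
  exact₂ : Function.Exact g₁ δ
  exact₃ : Function.Exact δ f₂
  exact₄ : Function.Exact f₂ g₂
  g₂_surjective : Function.Surjective g₂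
  /-- the zeta ratio `c` (`= u·p^a`). -/
  c : IwasawaAlgebra p
  c_ne_zero : c ≠ 0
  /-- `Z(f,T') = c·Z(f,T)` on the trivial component. -/
  f₁_z : f₁ D'.z = c • D.z

namespace LatticeChange

variable {D' D : KatoDescentDatum p} (L : LatticeChange D' D)

/-- **The Euler-characteristic identity of the lattice change**: at every height-one `𝔮`,
`ℓ_𝔮(𝐇¹(C)⁰) = ℓ_𝔮(𝐇²(C)⁰) + ℓ_𝔮(Λ/(c))` — at `𝔮 = (p)` this is `μ(𝐇¹(C)⁰) − μ(𝐇²(C)⁰) = ord_p #C⁻ = a`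
(Tate's global Euler–Poincaré characteristic over the totally real `ℚ_n`, with `c = u·p^a`,
`p^a = #C⁻`), off `(p)` it is `0 = 0 + 0`. [cite: NeukirchSchmidtWingberg2008, (8.7.4)] [cite: Kato2004Asterisque, Thm. 14.5 (2) (p. 236)] -/
def EulerCharIdentity : Prop :=
  ∀ 𝔮 : PrimeSpectrum (IwasawaAlgebra p), 𝔮.asIdeal.height = 1 →
    Module.lengthAt (IwasawaAlgebra p) L.X₁ 𝔮 =
      Module.lengthAt (IwasawaAlgebra p) L.X₂ 𝔮 +
        Module.lengthAt (IwasawaAlgebra p) (IwasawaAlgebra p ⧸ Ideal.span {L.c}) 𝔮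

/-- **Conj. 12.10⁰ is invariant under the lattice change** (tree theorem
`Kato2004.lengthAt_eq_iff_of_latticeChange`, height-one prime by height-one prime), granted the
Euler-characteristic identity. [cite: Kato2004Asterisque, Conj. 12.10 (p. 224)] -/
theorem conj1210_iff (hEC : L.EulerCharIdentity) : D.Conj1210 ↔ D'.Conj1210 := by
  haveI := L.finX₂
  have key := fun (𝔮 : PrimeSpectrum (IwasawaAlgebra p)) (h𝔮 : 𝔮.asIdeal.height = 1) ↦
    (Kato2004.lengthAt_eq_iff_of_latticeChange L.f₁ L.g₁ L.δ L.f₂ L.g₂ L.f₁_injective L.exact₁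
      L.exact₂ L.exact₃ L.exact₄ L.g₂_surjective L.c_ne_zero D.z D.z_ne_zero D'.z L.f₁_z
      D.isTorsion_quotient D'.isTorsion_quotient D.isTorsion_H2 D'.isTorsion_H2 L.isTorsion_X₂ 𝔮 h𝔮
      (hEC 𝔮 h𝔮)).1
  exact ⟨fun h 𝔮 h𝔮 ↦ (key 𝔮 h𝔮).mp (h 𝔮 h𝔮), fun h 𝔮 h𝔮 ↦ (key 𝔮 h𝔮).mpr (h 𝔮 h𝔮)⟩

/-- **The divisibility of Thm. 12.5 (4) is invariant under the lattice change**, granted the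
Euler-characteristic identity. [cite: Kato2004Asterisque, Thm. 12.5 (4) (p. 222)] -/
theorem divisibility_iff (hEC : L.EulerCharIdentity) : D.Divisibility ↔ D'.Divisibility := by
  haveI := L.finX₂
  have key := fun (𝔮 : PrimeSpectrum (IwasawaAlgebra p)) (h𝔮 : 𝔮.asIdeal.height = 1) ↦
    (Kato2004.lengthAt_eq_iff_of_latticeChange L.f₁ L.g₁ L.δ L.f₂ L.g₂ L.f₁_injective L.exact₁
      L.exact₂ L.exact₃ L.exact₄ L.g₂_surjective L.c_ne_zero D.z D.z_ne_zero D'.z L.f₁_z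
      D.isTorsion_quotient D'.isTorsion_quotient D.isTorsion_H2 D'.isTorsion_H2 L.isTorsion_X₂ 𝔮 h𝔮
      (hEC 𝔮 h𝔮)).2
  exact ⟨fun h 𝔮 h𝔮 ↦ (key 𝔮 h𝔮).mp (h 𝔮 h𝔮), fun h 𝔮 h𝔮 ↦ (key 𝔮 h𝔮).mpr (h 𝔮 h𝔮)⟩

end LatticeChange

end KatoDescentDatum

/-! ## §2 The reading and the isogeny invariance of `KMC` -/

section Readings

variable (IsOf : ∀ (W : WeierstrassCurve ℚ) [W.IsElliptic] [W.IsGloballyMinimal] (p : ℕ) [Fact p.Prime],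
  KatoDescentDatum p → Prop)
variable (KMC : ∀ (W : WeierstrassCurve ℚ) [W.IsElliptic] [W.IsGloballyMinimal] (p : ℕ), Prop)

/-- **READING — realised data of `ℚ`-isogenous curves are joined by a lattice change with the
Euler-characteristic identity.** For `W ∼ W'` globally minimal and data `D` of `T_pW`, `D'` of
`T_pW'` (an isogeny `φ : W' → W` embeds `T_pW'` in `T_pW` with finite quotient `C`): the `Λ`-adic
sequence of `0 → T_pW' → T_pW → C → 0` on the trivial component (Kato 8.2; `𝐇⁰(C) = 0`, `cd_p = 2`;
`𝐇^q(C)` finitely generated, killed by `#C`), the zeta relation `f₁ z' = u·p^a·z`,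
`p^a = [T(−1)⁺ : T'(−1)⁺] = #C⁻` (Thm. 12.5 (1)–(2), Thm. 14.5 (2): on the trivial component `z_γ = 0`
iff `γ⁺ = 0`), and Tate's Euler–Poincaré characteristic `μ(𝐇¹(C)⁰) − μ(𝐇²(C)⁰) = ord_p #C⁻`
(`p` odd). Hypothesis schema over the interface; nothing asserted.
[cite: Kato2004Asterisque, 8.2 (pp. 180–181), Thm. 12.5 (1)–(2) (p. 221), Thm. 14.5 (2) (p. 236)]
[cite: NeukirchSchmidtWingberg2008, (8.7.4)] -/
def LatticeChangeReading : Prop :=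
  ∀ (W W' : WeierstrassCurve ℚ) [W.IsElliptic] [W.IsGloballyMinimal] [W'.IsElliptic]
    [W'.IsGloballyMinimal] (p : ℕ) [Fact p.Prime] (D D' : KatoDescentDatum p),
    p ≠ 2 → IsIsogenous W W' → IsOf W p D → IsOf W' p D' →
    ∃ L : KatoDescentDatum.LatticeChange D' D, L.EulerCharIdentity

variable {IsOf} {KMC}

/-- **`KMC_p` IS AN INVARIANT OF THE `ℚ`-ISOGENY CLASS (over the readings).** For `ℚ`-isogenous
globally minimal `W ∼ W'` at an odd `p`, with realised descent data `D` of `W` and `D'` of `W'`: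
`KMC W p ↔ KMC W' p` — from the interface lemma `ReadsTrivialKMC` (what `KMC` means on a datum), the
lattice-change reading, and the kernel theorem `LatticeChange.conj1210_iff`. Conditional over displayed
readings; nothing about Kato's objects is asserted. [cite: Kato2004Asterisque, Conj. 12.10 (p. 224), 8.2 (pp. 180–181)]
[cite: NeukirchSchmidtWingberg2008, (8.7.4)] -/
theorem kmc_iff_of_isIsogenous (hread : ReadsTrivialKMC IsOf KMC) (hL : LatticeChangeReading IsOf)
    {W W' : WeierstrassCurve ℚ} [W.IsElliptic] [W.IsGloballyMinimal] [W'.IsElliptic]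
    [W'.IsGloballyMinimal] {p : ℕ} [Fact p.Prime] {D D' : KatoDescentDatum p} (hp : p ≠ 2)
    (hiso : IsIsogenous W W') (hD : IsOf W p D) (hD' : IsOf W' p D') : KMC W p ↔ KMC W' p := by
  obtain ⟨L, hEC⟩ := hL W W' p D D' hp hiso hD hD'
  rw [hread W p D hD, hread W' p D' hD', L.conj1210_iff hEC]

/-- **The divisibility of Thm. 12.5 (4) is likewise class-invariant over the readings** (so a
`DivisibilityReading` at one member with a realised datum serves every member with one).
[cite: Kato2004Asterisque, Thm. 12.5 (4) (p. 222)] [cite: NeukirchSchmidtWingberg2008, (8.7.4)] -/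
theorem divisibility_iff_of_isIsogenous (hL : LatticeChangeReading IsOf)
    {W W' : WeierstrassCurve ℚ} [W.IsElliptic] [W.IsGloballyMinimal] [W'.IsElliptic]
    [W'.IsGloballyMinimal] {p : ℕ} [Fact p.Prime] {D D' : KatoDescentDatum p} (hp : p ≠ 2)
    (hiso : IsIsogenous W W') (hD : IsOf W p D) (hD' : IsOf W' p D') :
    D.Divisibility ↔ D'.Divisibility := by
  obtain ⟨L, hEC⟩ := hL W W' p D D' hp hiso hD hD'
  exact L.divisibility_iff hEC

/-- **Consequence for the (12.5.2) rows: `KMC` at ONE member gives `KMC` at every member** (data exist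
at every member by part 1's `Realizable`; `Addv ∧ ord_p j ≥ 0` and (12.5.2) are hypotheses at both ends —
their transport is `Addv.of_isIsogenous_of_padicValRat_j_nonneg` and the isogeny-invariance of the
`p`-adic image, not re-proved here). [cite: Kato2004Asterisque, Conj. 12.10 (p. 224), (12.5.2) (p. 222)] -/
theorem kmc_of_isIsogenous_of_kmc (hread : ReadsTrivialKMC IsOf KMC) (hL : LatticeChangeReading IsOf)
    (hreal : Realizable IsOf) {W W' : WeierstrassCurve ℚ} [W.IsElliptic] [W.IsGloballyMinimal]
    [W'.IsElliptic] [W'.IsGloballyMinimal] {p : ℕ} [Fact p.Prime] (hp : p ≠ 2)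
    (hiso : IsIsogenous W W') (hadd : Addv W p) (hj : 0 ≤ padicValRat p W.j)
    (hK : Kato2004.ImageContainsSL2 W p) (hadd' : Addv W' p) (hj' : 0 ≤ padicValRat p W'.j)
    (hK' : Kato2004.ImageContainsSL2 W' p) (h : KMC W p) : KMC W' p := by
  obtain ⟨D, hD⟩ := hreal W p hp hadd hj hK
  obtain ⟨D', hD'⟩ := hreal W' p hp hadd' hj' hK'
  exact (kmc_iff_of_isIsogenous hread hL hp hiso hD hD').mp h

end Readings

end Summit.BirchSwinnertonDyer.Rank1Residual.Additive

end
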